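import Literature.Probability.RandomPlanarGeometry.ObliqueRBMWedgeIdentify
import Literature.Probability.RandomPlanarGeometry.ObliqueRBMWedgeBeta
import Mathlib.MeasureTheory.Integral.Prod
import HarnessLib

/-!
# The apex identity in real form: `Re Φ(∞) − Re Φₑ(rz) = ∫₀¹ π ρ̃ m (1 − scRatio)`

Layer of the proof of
`Literature.Probability.RandomPlanarGeometry.LawlerSchrammWerner2001_orbm_uniformHitting`
(`ObliqueRBMWedge.lean`). For the test kernel of `D : TestIntervals`:

* `gRe_eq_integral` — on the negative axis, `gRe(x) = ∫₀¹ m(y)/(x − y) dy` (real FTC for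
  `−log(y − x)`);
* `integral_Iic_weight_gRe` — Tonelli: `∫_{-∞}^0 |x|^{-1/3}(1−x)^{-1/3} gRe(x) dx = −∫₀¹ m(y) M(y) dy`,
  `M(y) = ∫₀^∞ u^{-1/3}(1+u)^{-1/3}/(u + y) du`;
* `re_phiInf_sub_re_phiExt` — with the apex identity `∫_{Iic 0} Φ' = Φₑ(0) − Φ(∞)`
  (`ObliqueRBMWedgeBoundary`) and the Euler/Carleson identity `carleson_linearity_Ioi`
  (`ObliqueRBMWedgeBeta`): `Re Φ(∞) − Re Φₑ(rz) = ∫₀¹ π ρ̃(y) m(y) (1 − scRatio y) dy`;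
* `re_phiExt_eq_indicator` — the trace identity in indicator form:
  `Re Φₑ(u) = Re Φₑ(rz) + ∫₀¹ 𝟙{y < u} π ρ̃ m` for `u ∈ [0, 1]`.

## References

* J. Dubédat, Ann. IHP 40 (2004), §4; L. Carleson's form of Cardy's formula (Smirnov 2001). [Dubedat2004]
-/

noncomputable section

open Set Filter Topology Complex MeasureTheory intervalIntegral Metric
open scoped Real Interval
open UpperHalfPlane (upperHalfPlaneSet isOpen_upperHalfPlaneSet)

namespace Literature.Probability.RandomPlanarGeometry

/-! ### Elementary integrals -/

/-- `∫_a^b dy/(x − y) = log(a − x) − log(b − x)` for `x < a ≤ b`. [folklore] -/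
theorem integral_inv_sub {x a b : ℝ} (hxa : x < a) (hab : a ≤ b) :
    ∫ y in a..b, 1 / (x - y) = Real.log (a - x) - Real.log (b - x) := by
  have hderiv : ∀ y ∈ uIcc a b, HasDerivAt (fun y : ℝ ↦ -Real.log (y - x)) (1 / (x - y)) y := by
    intro y hy
    rw [uIcc_of_le hab] at hy
    have hyx : y - x ≠ 0 := by linarith [hy.1]
    have h := ((hasDerivAt_id y).sub_const x).log hyx
    have h' := h.neg
    simp only [id, one_div] at h'
    refine h'.congr_deriv ?_
    have : x - y ≠ 0 := by linarith [hy.1]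
    rw [one_div, ← inv_neg, neg_sub]
  have hcont : ContinuousOn (fun y : ℝ ↦ 1 / (x - y)) (uIcc a b) := by
    rw [uIcc_of_le hab]
    refine ContinuousOn.div continuousOn_const (continuousOn_const.sub continuousOn_id) fun y hy ↦ ?_
    linarith [hy.1]
  rw [intervalIntegral.integral_eq_sub_of_hasDerivAt hderiv (hcont.intervalIntegrable)]
  ring

/-- Auxiliary statement (`intervalIntegrable_indicator_mul_inv_sub`). [folklore] -/
theorem intervalIntegrable_indicator_mul_inv_sub {x : ℝ} (hx : x < 0) (a b c : ℝ) :
    IntervalIntegrable (fun y ↦ (Ioo a b).indicator (fun _ ↦ c) y * (1 / (x - y))) volume 0 1 := by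
  have hmeas : Measurable fun y : ℝ ↦ (Ioo a b).indicator (fun _ ↦ c) y * (1 / (x - y)) :=
    (measurable_const.indicator measurableSet_Ioo).mul (measurable_const.div (measurable_const.sub measurable_id))
  refine (intervalIntegrable_const (c := |c| * (1 / -x))).mono_fun' hmeas.aestronglyMeasurable ?_
  rw [uIoc_of_le zero_le_one]
  refine (ae_restrict_iff' measurableSet_Ioc).2 (ae_of_all _ fun y hy ↦ ?_)
  show ‖(Ioo a b).indicator (fun _ ↦ c) y * (1 / (x - y))‖ ≤ |c| * (1 / -x)
  rw [Real.norm_eq_abs, abs_mul]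
  have hxy : 0 < y - x := by linarith [hy.1]
  have h1 : |(Ioo a b).indicator (fun _ ↦ c) y| ≤ |c| := by
    by_cases h : y ∈ Ioo a b
    · rw [indicator_of_mem h]
    · rw [indicator_of_notMem h, abs_zero]; exact abs_nonneg _
  have h2 : |1 / (x - y)| ≤ 1 / -x := by
    rw [abs_div, abs_one, abs_of_neg (by linarith), neg_sub]
    exact one_div_le_one_div_of_le (by linarith) (by linarith [hy.1])
  exact mul_le_mul h1 h2 (abs_nonneg _) (abs_nonneg _)

namespace TestIntervals

variable (D : TestIntervals)

/-- **`gRe` as a Cauchy integral on the negative axis**: `gRe(x) = ∫₀¹ m(y)/(x − y) dy`, `x < 0`.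
[folklore] -/
theorem gRe_eq_integral {x : ℝ} (hx : x < 0) : D.gRe x = ∫ y in (0:ℝ)..1, D.m y / (x - y) := by
  have hα := D.hα; have hαβ := D.hαβ; have hβ := D.hβ; have hγ := D.hγ; have hγδ := D.hγδ; have hδ := D.hδ
  have hsplit : ∀ y, D.m y / (x - y) = (Ioo D.α D.β).indicator (fun _ ↦ 1 / (D.β - D.α)) y * (1 / (x - y))
      - (Ioo D.γ D.δ).indicator (fun _ ↦ 1 / (D.δ - D.γ)) y * (1 / (x - y)) := by
    intro y; simp only [m]; ring
  simp_rw [hsplit]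
  rw [intervalIntegral.integral_sub, integral_indicator_Ioo_mul hα.le hαβ.le hβ.le, integral_indicator_Ioo_mul hγ.le hγδ.le hδ.le,
    integral_inv_sub (hx.trans hα) hαβ.le, integral_inv_sub (hx.trans hγ) hγδ.le]
  · rw [gRe, abs_of_neg (by linarith), abs_of_neg (by linarith), abs_of_neg (by linarith), abs_of_neg (by linarith),
      Real.log_div (by linarith) (by linarith), Real.log_div (by linarith) (by linarith)]
    simp only [neg_sub]
    ring
  · exact intervalIntegrable_indicator_mul_inv_sub hx _ _ _
  · exact intervalIntegrable_indicator_mul_inv_sub hx _ _ _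

/-! ### The Tonelli step -/

/-- The weight `w(x) = |x|^{-1/3}(1 − x)^{-1/3}` on the negative axis. [folklore] -/
def negWeight (x : ℝ) : ℝ := (-x) ^ (-(1 / 3 : ℝ)) * (1 - x) ^ (-(1 / 3 : ℝ))

/-- The transform `M(y) = ∫₀^∞ u^{-1/3}(1+u)^{-1/3}/(u + y) du`. [folklore] -/
def Mfun (y : ℝ) : ℝ := ∫ u in Ioi (0:ℝ), u ^ (-(1 / 3 : ℝ)) * (1 + u) ^ (-(1 / 3 : ℝ)) / (u + y)

/-- Auxiliary statement (`measurable_negWeight`). [folklore] -/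
theorem measurable_negWeight : Measurable negWeight := by
  unfold negWeight
  exact (measurable_neg.pow_const _).mul ((measurable_const.sub measurable_id).pow_const _)

/-- Auxiliary statement (`negWeight_nonneg`). [folklore] -/
theorem negWeight_nonneg {x : ℝ} (hx : x < 0) : 0 ≤ negWeight x :=
  mul_nonneg (Real.rpow_nonneg (by linarith) _) (Real.rpow_nonneg (by linarith) _)

/-- Auxiliary statement (`negWeight_neg`). [folklore] -/
theorem negWeight_neg (u : ℝ) : negWeight (-u) = u ^ (-(1 / 3 : ℝ)) * (1 + u) ^ (-(1 / 3 : ℝ)) := by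
  rw [negWeight, neg_neg, sub_neg_eq_add]

/-- Lower endpoint of the support of `m`. [folklore] -/
def lo : ℝ := min D.α D.γ

/-- Auxiliary statement (`lo_pos`). [folklore] -/
theorem lo_pos : 0 < D.lo := lt_min D.hα D.hγ

/-- Auxiliary statement (`m_eq_zero_of_le_lo`). [folklore] -/
theorem m_eq_zero_of_le_lo {y : ℝ} (hy : y ≤ D.lo) : D.m y = 0 := D.m_eq_zero_of_not_mem (Or.inl hy)

/-- The bound `|m| ≤ Cm`. [folklore] -/
def Cm : ℝ := 1 / (D.β - D.α) + 1 / (D.δ - D.γ)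

/-- Auxiliary statement (`Cm_nonneg`). [folklore] -/
theorem Cm_nonneg : 0 ≤ D.Cm := by
  have hba : 0 < D.β - D.α := by linarith [D.hαβ]
  have hdg : 0 < D.δ - D.γ := by linarith [D.hγδ]
  unfold Cm; positivity

/-- The dominating `x`-function `w(x)/(lo − x)` is integrable on `(−∞, 0)`. [folklore] -/
theorem integrableOn_negWeight_div : IntegrableOn (fun x ↦ negWeight x / (D.lo - x)) (Iio 0) := by
  have hlo := D.lo_pos
  have hmeas : Measurable fun x ↦ negWeight x / (D.lo - x) :=
    measurable_negWeight.div (measurable_const.sub measurable_id)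
  -- near zero: `(−1, 0)`, bound `(-x)^{-1/3} / lo`
  have h1 : IntegrableOn (fun x ↦ negWeight x / (D.lo - x)) (Ioo (-1) 0) := by
    have hg : IntegrableOn (fun x : ℝ ↦ (-x) ^ (-(1 / 3 : ℝ)) * (1 / D.lo)) (Ioo (-1) 0) := by
      have h := ((intervalIntegral.intervalIntegrable_rpow' (a := 1) (b := 0) (r := -(1 / 3 : ℝ))
        (by norm_num)).comp_sub_left 0).mul_const (1 / D.lo)
      have h2 := h.def'
      simp only [zero_sub, sub_self] at h2
      rw [uIoc_of_le (by norm_num : (-1:ℝ) ≤ 0)] at h2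
      exact h2.mono_set Ioo_subset_Ioc_self
    refine hg.mono' hmeas.aestronglyMeasurable ((ae_restrict_iff' measurableSet_Ioo).2 (ae_of_all _ fun x hx ↦ ?_))
    rw [Real.norm_eq_abs, abs_of_nonneg (div_nonneg (negWeight_nonneg hx.2) (by linarith [hx.2]))]
    rw [negWeight, div_eq_mul_one_div]
    have hP : 0 ≤ (-x) ^ (-(1 / 3 : ℝ)) := Real.rpow_nonneg (by linarith [hx.2]) _
    have hQ : (1 - x) ^ (-(1 / 3 : ℝ)) ≤ 1 := Real.rpow_le_one_of_one_le_of_nonpos (by linarith [hx.2]) (by norm_num)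
    have hQ0 : 0 ≤ (1 - x) ^ (-(1 / 3 : ℝ)) := Real.rpow_nonneg (by linarith [hx.2]) _
    have hR : 1 / (D.lo - x) ≤ 1 / D.lo := one_div_le_one_div_of_le hlo (by linarith [hx.2])
    have hR0 : 0 ≤ 1 / (D.lo - x) := by have : 0 < D.lo - x := by linarith [hx.2]
                                        positivity
    calc (-x) ^ (-(1 / 3 : ℝ)) * (1 - x) ^ (-(1 / 3 : ℝ)) * (1 / (D.lo - x))
        ≤ (-x) ^ (-(1 / 3 : ℝ)) * 1 * (1 / D.lo) := by gcongr
      _ = (-x) ^ (-(1 / 3 : ℝ)) * (1 / D.lo) := by ring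
  -- the tail `(−∞, −1]`, bound `(-x)^{-5/3}`
  have h2 : IntegrableOn (fun x ↦ negWeight x / (D.lo - x)) (Iic (-1)) := by
    have hg : IntegrableOn (fun x : ℝ ↦ (-x) ^ (-(5 / 3 : ℝ))) (Iic (-1)) := by
      rw [← Measure.map_neg_eq_self (volume : Measure ℝ)]
      let me : MeasurableEmbedding fun x : ℝ => -x := (Homeomorph.neg ℝ).measurableEmbedding
      rw [me.integrableOn_map_iff]
      simp_rw [Function.comp_def, neg_preimage, Set.neg_Iic, neg_neg]
      rw [integrableOn_Ici_iff_integrableOn_Ioi]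
      exact integrableOn_Ioi_rpow_of_lt (by norm_num) (by norm_num)
    refine hg.mono' hmeas.aestronglyMeasurable ((ae_restrict_iff' measurableSet_Iic).2 (ae_of_all _ fun x hx ↦ ?_))
    have hx1 : x ≤ -1 := hx
    have hxpos : 0 < -x := by linarith
    rw [Real.norm_eq_abs, abs_of_nonneg (div_nonneg (negWeight_nonneg (by linarith)) (by linarith))]
    rw [negWeight, div_eq_mul_one_div]
    have hP : 0 ≤ (-x) ^ (-(1 / 3 : ℝ)) := Real.rpow_nonneg hxpos.le _
    have hQ : (1 - x) ^ (-(1 / 3 : ℝ)) ≤ (-x) ^ (-(1 / 3 : ℝ)) :=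
      Real.rpow_le_rpow_of_nonpos hxpos (by linarith) (by norm_num)
    have hQ0 : 0 ≤ (1 - x) ^ (-(1 / 3 : ℝ)) := Real.rpow_nonneg (by linarith) _
    have hR : 1 / (D.lo - x) ≤ 1 / (-x) := one_div_le_one_div_of_le hxpos (by linarith)
    have hR0 : 0 ≤ 1 / (D.lo - x) := by have : 0 < D.lo - x := by linarith
                                        positivity
    calc (-x) ^ (-(1 / 3 : ℝ)) * (1 - x) ^ (-(1 / 3 : ℝ)) * (1 / (D.lo - x))
        ≤ (-x) ^ (-(1 / 3 : ℝ)) * (-x) ^ (-(1 / 3 : ℝ)) * (1 / (-x)) := by gcongr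
      _ = (-x) ^ (-(5 / 3 : ℝ)) := by
          rw [show (1 : ℝ) / -x = (-x) ^ (-(1:ℝ)) by rw [Real.rpow_neg_one, one_div], ← Real.rpow_add hxpos,
            ← Real.rpow_add hxpos]
          norm_num
  have := h2.union h1
  rwa [Iic_union_Ioo_eq_Iio (by norm_num : (-1:ℝ) < 0)] at this

/-- **Domination of the double integrand**: `|w(x) m(y)/(x − y)| ≤ Cm · w(x)/(lo − x)` for `x < 0`,
`y ∈ (0, 1]`. [folklore] -/
theorem abs_integrand_le {x : ℝ} (hx : x < 0) (y : ℝ) :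
    |negWeight x * (D.m y / (x - y))| ≤ negWeight x / (D.lo - x) * D.Cm := by
  have hlo := D.lo_pos
  have hw := negWeight_nonneg hx
  by_cases hy : y ≤ D.lo
  · rw [D.m_eq_zero_of_le_lo hy, zero_div, mul_zero, abs_zero]
    exact mul_nonneg (div_nonneg hw (by linarith)) D.Cm_nonneg
  · rw [not_le] at hy
    rw [abs_mul, abs_of_nonneg hw, abs_div, div_mul_eq_mul_div, mul_div_assoc]
    refine mul_le_mul_of_nonneg_left ?_ hw
    rw [abs_of_neg (by linarith : x - y < 0), neg_sub]
    calc |D.m y| / (y - x) ≤ D.Cm / (y - x) := div_le_div_of_nonneg_right (D.abs_m_le y) (by linarith)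
      _ ≤ D.Cm / (D.lo - x) := div_le_div_of_nonneg_left D.Cm_nonneg (by linarith) (by linarith)

/-- **Integrability of the double integrand** on `(−∞,0) × (0,1]`. [folklore] -/
theorem integrable_prod_integrand :
    Integrable (Function.uncurry fun x y ↦ negWeight x * (D.m y / (x - y)))
      ((volume.restrict (Iio (0:ℝ))).prod (volume.restrict (Ioc (0:ℝ) 1))) := by
  have hG : Integrable (fun p : ℝ × ℝ ↦ negWeight p.1 / (D.lo - p.1) * D.Cm)
      ((volume.restrict (Iio (0:ℝ))).prod (volume.restrict (Ioc (0:ℝ) 1))) := by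
    have h1 : Integrable (fun x ↦ negWeight x / (D.lo - x)) (volume.restrict (Iio (0:ℝ))) := D.integrableOn_negWeight_div
    have h2 : Integrable (fun _ : ℝ ↦ D.Cm) (volume.restrict (Ioc (0:ℝ) 1)) := integrable_const _
    exact h1.mul_prod h2
  have hmeas : Measurable (Function.uncurry fun x y : ℝ ↦ negWeight x * (D.m y / (x - y))) := by
    refine (measurable_negWeight.comp measurable_fst).mul ((D.measurable_m.comp measurable_snd).div ?_)
    exact measurable_fst.sub measurable_snd
  refine hG.mono' hmeas.aestronglyMeasurable ?_
  rw [Measure.prod_restrict, ae_restrict_iff' (measurableSet_Iio.prod measurableSet_Ioc)]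
  refine ae_of_all _ fun p hp ↦ ?_
  rw [Real.norm_eq_abs]
  exact D.abs_integrand_le hp.1 p.2

/-- The inner `x`-integral after the swap: `∫_{x<0} w(x)/(x − y) dx = −M(y)`. [folklore] -/
theorem integral_Iio_negWeight_div (y : ℝ) : ∫ x in Iio (0:ℝ), negWeight x / (x - y) = -Mfun y := by
  rw [← integral_Iic_eq_integral_Iio, ← neg_zero, ← integral_comp_neg_Ioi 0 (fun x ↦ negWeight x / (x - y)), Mfun,
    ← MeasureTheory.integral_neg]
  refine setIntegral_congr_fun measurableSet_Ioi fun u _ ↦ ?_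
  rw [negWeight_neg]
  rw [show -u - y = -(u + y) by ring, div_neg]

/-- **Tonelli**: `∫_{x ≤ 0} w(x) gRe(x) dx = −∫₀¹ m(y) M(y) dy`. [folklore] -/
theorem integral_Iic_negWeight_gRe :
    ∫ x in Iic (0:ℝ), negWeight x * D.gRe x = -∫ y in (0:ℝ)..1, D.m y * Mfun y := by
  rw [integral_Iic_eq_integral_Iio]
  -- replace `gRe` by its integral representation on `Iio 0`
  have h1 : ∫ x in Iio (0:ℝ), negWeight x * D.gRe x = ∫ x in Iio (0:ℝ), ∫ y in Ioc (0:ℝ) 1, negWeight x * (D.m y / (x - y)) := by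
    refine setIntegral_congr_fun measurableSet_Iio fun x hx ↦ ?_
    rw [D.gRe_eq_integral hx, intervalIntegral.integral_of_le zero_le_one, ← MeasureTheory.integral_const_mul]
  rw [h1, integral_integral_swap D.integrable_prod_integrand]
  -- inner integral in `x`
  have h2 : ∀ y, ∫ x in Iio (0:ℝ), negWeight x * (D.m y / (x - y)) = D.m y * (-Mfun y) := by
    intro y
    rw [← integral_Iio_negWeight_div y, ← MeasureTheory.integral_const_mul]
    congr 1; funext x; ring
  simp_rw [h2]
  rw [intervalIntegral.integral_of_le zero_le_one, ← MeasureTheory.integral_neg]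
  congr 1; funext y; ring

/-! ### The apex identity in real form -/

/-- `M(y) = (2π/√3) ρ̃(y) (1 − scRatio y)` on `(0, 1)` (Carleson / Euler identity). [folklore] -/
theorem Mfun_eq {y : ℝ} (hy : y ∈ Ioo (0:ℝ) 1) : Mfun y = 2 * π / Real.sqrt 3 * (rhoTilde y * (1 - scRatio y)) := by
  have h := carleson_linearity_Ioi hy
  rw [← Mfun] at h
  have h3 : 0 < Real.sqrt 3 := by positivity
  have hπ := Real.pi_pos
  have hy13 : 0 < y ^ (1 / 3 : ℝ) := Real.rpow_pos_of_pos hy.1 _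
  have h1y13 : 0 < (1 - y) ^ (1 / 3 : ℝ) := Real.rpow_pos_of_pos (by linarith [hy.2]) _
  have hρ : rhoTilde y = 1 / (y ^ (1 / 3 : ℝ) * (1 - y) ^ (1 / 3 : ℝ)) := by
    rw [rhoTilde, Real.rpow_neg hy.1.le, Real.rpow_neg (by linarith [hy.2])]
    field_simp
  rw [scRatio, ← h, hρ]
  field_simp

/-- **The apex identity, real form**: `Re Φ(∞) − Re Φₑ(0) = ∫₀¹ π ρ̃ m (1 − scRatio)`. [folklore] -/
theorem re_phiInf_sub_re_phiExt_zero :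
    (D.phiInf).re - (D.phiExt 0).re = ∫ y in (0:ℝ)..1, π * rhoTilde y * D.m y * (1 - scRatio y) := by
  -- `Φₑ(0) − Φ(∞) = ∫_{Iic 0} Φ'`
  have hapex := D.integral_phiKernel_Iic
  have hint := D.integrableOn_phiKernel_Iic
  have hre : (∫ x in Iic (0:ℝ), D.phiKernel x).re = ∫ x in Iic (0:ℝ), (D.phiKernel x).re := by
    have := integral_re hint
    simpa using this.symm
  -- real part of the kernel on the negative axis
  have hker : ∫ x in Iic (0:ℝ), (D.phiKernel x).re = Real.sqrt 3 / 2 * ∫ x in Iic (0:ℝ), negWeight x * D.gRe x := by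
    rw [← MeasureTheory.integral_const_mul, integral_Iic_eq_integral_Iio, integral_Iic_eq_integral_Iio]
    refine setIntegral_congr_fun measurableSet_Iio fun x hx ↦ ?_
    rw [D.phiKernel_ofReal_neg hx, ← negWeight]
    rw [mul_comm, re_ofReal_mul, Complex.exp_ofReal_mul_I_re, Real.cos_pi_div_six]
    ring
  have h1 : (D.phiInf).re - (D.phiExt 0).re = -(∫ x in Iic (0:ℝ), (D.phiKernel x).re) := by
    rw [← hre, hapex, sub_re]; ring
  rw [h1, hker, D.integral_Iic_negWeight_gRe, mul_neg, neg_neg, ← intervalIntegral.integral_const_mul]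
  refine intervalIntegral.integral_congr fun y hy ↦ ?_
  rw [uIcc_of_le zero_le_one] at hy
  rcases hy.1.lt_or_eq with hy0 | hy0
  · rcases hy.2.lt_or_eq with hy1 | hy1
    · rw [Mfun_eq ⟨hy0, hy1⟩]
      have h3 : Real.sqrt 3 ≠ 0 := by positivity
      field_simp
    · rw [hy1, D.m_eq_zero_of_not_mem (Or.inr (max_lt D.hβ D.hδ).le)]; simp
  · rw [← hy0, D.m_eq_zero_of_le_lo D.lo_pos.le]; simp

/-- The trace density vanishes on `[0, rz]`, so `Re Φₑ(0) = Re Φₑ(rz)`. [folklore] -/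
theorem re_phiExt_zero_eq : (D.phiExt 0).re = (D.phiExt D.rz).re := by
  have h := D.re_phiExt_eq (u := 0) ⟨le_rfl, zero_le_one⟩
  rw [ofReal_zero] at h
  rw [h, intervalIntegral.integral_symm]
  have hz : ∫ x in (0:ℝ)..D.rz, π * rhoTilde x * D.m x = 0 := by
    have heq : ∫ x in (0:ℝ)..D.rz, π * rhoTilde x * D.m x = ∫ x in (0:ℝ)..D.rz, (0:ℝ) := by
      refine intervalIntegral.integral_congr fun y hy ↦ ?_
      rw [uIcc_of_le D.rz_pos.le] at hy
      have : y ≤ D.lo := by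
        have : D.rz ≤ D.lo := by unfold rz lo; linarith [(lt_min D.hα D.hγ).le]
        exact hy.2.trans this
      simp [D.m_eq_zero_of_le_lo this]
    rw [heq, intervalIntegral.integral_zero]
  rw [hz, neg_zero, add_zero]

/-- **The apex identity from the base point `rz`**:
`Re Φ(∞) − Re Φₑ(rz) = ∫₀¹ π ρ̃ m (1 − scRatio)`. [folklore] -/
theorem re_phiInf_sub_re_phiExt_rz :
    (D.phiInf).re - (D.phiExt D.rz).re = ∫ y in (0:ℝ)..1, π * rhoTilde y * D.m y * (1 - scRatio y) := by
  rw [← D.re_phiExt_zero_eq]; exact D.re_phiInf_sub_re_phiExt_zero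

/-! ### The trace identity in indicator form -/

/-- **Trace identity, indicator form**: for `u ∈ [0, 1]`,
`Re Φₑ(u) = Re Φₑ(rz) + ∫₀¹ 𝟙{y < u} π ρ̃(y) m(y) dy`. [folklore] -/
theorem re_phiExt_eq_indicator {u : ℝ} (hu : u ∈ Icc (0:ℝ) 1) :
    (D.phiExt u).re = (D.phiExt D.rz).re + ∫ y in (0:ℝ)..1, (Iio u).indicator (fun y ↦ π * rhoTilde y * D.m y) y := by
  rw [D.re_phiExt_eq hu]
  congr 1
  have hf := D.intervalIntegrable_traceDensity
  -- `∫₀¹ 𝟙_{Iio u} f = ∫₀ᵘ f`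
  have hind : ∫ y in (0:ℝ)..1, (Iio u).indicator (fun y ↦ π * rhoTilde y * D.m y) y
      = ∫ y in (0:ℝ)..u, π * rhoTilde y * D.m y := by
    have hset : Iio u ∩ Ioc 0 1 = Ioo 0 u := by
      ext y; constructor
      · rintro ⟨h1, h2⟩; exact ⟨h2.1, h1⟩
      · rintro ⟨h1, h2⟩; exact ⟨h2, h1, (h2.le.trans hu.2)⟩
    rw [intervalIntegral.integral_of_le zero_le_one, intervalIntegral.integral_of_le hu.1,
      MeasureTheory.integral_indicator measurableSet_Iio, Measure.restrict_restrict measurableSet_Iio, hset,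
      integral_Ioc_eq_integral_Ioo]
  rw [hind]
  -- `∫_{rz}^u f = ∫₀ᵘ f − ∫₀^{rz} f` and the latter vanishes
  have hz : ∫ x in (0:ℝ)..D.rz, π * rhoTilde x * D.m x = 0 := by
    have heq : ∫ x in (0:ℝ)..D.rz, π * rhoTilde x * D.m x = ∫ x in (0:ℝ)..D.rz, (0:ℝ) := by
      refine intervalIntegral.integral_congr fun y hy ↦ ?_
      rw [uIcc_of_le D.rz_pos.le] at hy
      have : y ≤ D.lo := by
        have : D.rz ≤ D.lo := by unfold rz lo; linarith [(lt_min D.hα D.hγ).le]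
        exact hy.2.trans this
      simp [D.m_eq_zero_of_le_lo this]
    rw [heq, intervalIntegral.integral_zero]
  have hadd := intervalIntegral.integral_add_adjacent_intervals (hf 0 D.rz) (hf D.rz u)
  rw [hz, zero_add] at hadd
  exact hadd

end TestIntervals

end Literature.Probability.RandomPlanarGeometry
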